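import Summits.QuantumAdvantage.QuantumAdvantage.Theorems.MobiusLadderLiouvilleOrthogonalTC0FewMaj
import HarnessLib

/-!
# Crux `MobiusLadder.LiouvilleOrthogonalTC0` (stmt-QuantumAdvantage-1393), line `Sketch`, skeleton v9:
stub `stub_waist` (W1) — the narrow-waist rung

UNCONDITIONAL: any Boolean function `F` (a `MAJ`/`THR` gate, or anything at all) of `K ≤ n^β`
sub-circuits `C_1, …, C_K` from the few-majority class of skeleton v7 (over `tcBasis`, `acDepth ≤ d`,
`size ≤ p(n)`, majority gates of fan-in `≥ 3` only at `acWeight`-depth `≤ 1` and at most `c₁ log n` of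
them in each `C_a`) is asymptotically orthogonal to `λ`:
`|Σ_{N<2ⁿ} λ(N) sgn F(C_1(bits N), …, C_K(bits N))| ≤ ε 2ⁿ` eventually — e.g. a majority of `n^β`
`AC⁰` circuits. The constants `β = c₁ = δ/4`, `δ = 1/(2R)`, `R = ⌈3/c⌉₊`, depend only on the exponent
`c` of Bourgain's Möbius–Walsh bound (`bourgain_liouville_walsh_holds`).

Proof (the line's sensitivity calculus). Along any partition `π : Fin n → Fin m` the sensitive blocks
of `x ↦ F(C_1(x), …, C_K(x))` at `x` are covered by those of the `C_a` (`Waist.sens_comp_le`, the case of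
constant guesses in `FewMaj.sens_guess_le`), and each `C_a` has at most
`k_a 2ⁿ√m + 2^{k_a} 2ⁿ Φ(d,s)` pairs (point, sensitive block) (`FewMaj3.sens_fewMaj_le`, `k_a` = number of
majority gates of fan-in `≥ 3`, `Φ(d,s) = A^{d+2}B^{d+2}(logM 2s)^d / log 2`); with `k_a ≤ kmax`,
`2^{k_a} ≤ P` the Peres-type lemma `stub_tailOfSens` gives
`W^{≥m}[sgn ∘ F ∘ (C_a)] ≤ 3K(kmax + PΦ/√m)/√m` (`Waist.tailWeight_comp_le`). At the spectral level
`m = ⌊n^{1/R}⌋₊ + 1` (`√m ≥ n^δ`, `m ≥ n^{2δ}`), with `K ≤ n^{δ/4}`, `kmax = (δ/4) log n`,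
`P = n^{δ/4}` (`2^k ≤ n^{δ/4}` from `k ≤ (δ/4) log n`, `log 2 ≤ 1`), `log n ≤ (2/δ) n^{δ/2}` and
`Φ ≤ KK·Q·n^{5δ/4}` (`FewMaj3.eventually_logM_le`, `FewMaj3.log_pow_le` with exponent `5δ/2`), the tail
is `≤ (3/2 + 3·KK·Q) n^{-δ/4} → 0`, and the single-level spectral criterion
`liouville_orthogonal_of_tailWeight_level` (Bourgain + Green §2) finishes, exactly as in `…FewMaj.lean`.

* `Waist.sens_comp_le`, `Waist.tailWeight_comp_le` — the accounting for a composition;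
* `liouville_orthogonal_waist` — the rung; `stub_waist` — the registered stub (verbatim).
-/

set_option linter.dupNamespace false -- D-0017: single-problem summit ⇒ `QuantumAdvantage.QuantumAdvantage` by design

noncomputable section

namespace Summit.QuantumAdvantage.QuantumAdvantage.Theorems.LiouvilleOrthogonalTC0

open Filter Finset Topology
open Literature.Computability.Complexity
open Literature.Computability.Complexity.GateList
open Literature.Computability.Complexity.LowDegree (tailWeight)
open Literature.Probability.RandomGraphs.LowDegree (sgn)
open Literature.NumberTheory.Sieve

namespace Waist

variable {n m : ℕ}

/-! ### The accounting for a composition `F ∘ (L_1, …, L_K)` -/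

/-- **Block sensitivity of a composition.** For every partition `π` into `m` blocks, the number of
pairs (point, sensitive block) of `x ↦ F(L_1 x, …, L_K x)` is at most the sum over `a` of those of
`L_a`: a block flip that changes no `L_a` does not change `F ∘ L` (the case of constant guesses
`C_v = F v` in `FewMaj.sens_guess_le`, whose second sum then vanishes). -/
theorem sens_comp_le {K : ℕ} (F : (Fin K → Bool) → Bool) (L : Fin K → (Fin n → Bool) → Bool)
    (π : Fin n → Fin m) :
    ∑ x : Fin n → Bool, ((univ.filter fun j : Fin m =>
        F (fun a => L a x) ≠ F (fun a => L a (fun i => xor (x i) (decide (π i = j))))).card : ℝ)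
      ≤ ∑ a : Fin K, ∑ x : Fin n → Bool, ((univ.filter fun j : Fin m =>
            L a x ≠ L a (fun i => xor (x i) (decide (π i = j)))).card : ℝ) := by
  have h := FewMaj.sens_guess_le (m := m) (fun x => F (fun a => L a x)) L (fun v _ => F v)
    (fun _ => rfl) π
  calc _ ≤ ∑ a : Fin K, ∑ x : Fin n → Bool, ((univ.filter fun j : Fin m =>
            L a x ≠ L a (fun i => xor (x i) (decide (π i = j)))).card : ℝ)
        + ∑ v : Fin K → Bool, ∑ _x : Fin n → Bool, ((univ.filter fun _j : Fin m =>
            F v ≠ F v).card : ℝ) := h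
    _ = _ := by
        have h0 : ∑ v : Fin K → Bool, ∑ _x : Fin n → Bool, ((univ.filter fun _j : Fin m =>
            F v ≠ F v).card : ℝ) = 0 :=
          Finset.sum_eq_zero fun v _ => Finset.sum_eq_zero fun x _ => by simp
        rw [h0, add_zero]

/-- **Fourier tail of a function of `K` few-majority circuits.** If every `C_a` (`a < K`) is a
`tcBasis` circuit of `acDepth ≤ d`, `size ≤ s`, all of whose majority gates of fan-in `≥ 3` sit at
`acWeight`-depth `≤ 1`, with `k_a ≤ kmax` such gates and `2^{k_a} ≤ P`, then for `m ≥ 10` and ANY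
`F : {0,1}^K → {0,1}`:
`W^{≥ m}[sgn ∘ F ∘ (C_1, …, C_K)] ≤ 3 K (kmax + P Φ(d,s)/√m)/√m`,
`Φ(d,s) = A^{d+2} B^{d+2} (logM 2s)^d / log 2` (`sens_comp_le`, `FewMaj3.sens_fewMaj_le`,
`stub_tailOfSens`). -/
theorem tailWeight_comp_le (hm : 10 ≤ m) {K : ℕ} (F : (Fin K → Bool) → Bool)
    (Cs : Fin K → Circuit (Fin n)) {d s : ℕ} (h1 : 1 ≤ s) {kmax P : ℝ}
    (hCs : ∀ a, (Cs a).IsOver tcBasis ∧ (Cs a).acDepth ≤ d ∧ (Cs a).size ≤ s ∧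
      (∀ (j : ℕ) (hj : j < (Cs a).gates.length),
        (∃ k, 3 ≤ k ∧ ((Cs a).gates[j]).fn = GateFn.maj k) →
          (wdepths acWeight (Cs a).gates).getD j 0 ≤ 1) ∧
      (((univ.filter fun j : Fin (Cs a).gates.length =>
          3 ≤ ((Cs a).gates[j]).arity ∧
            ((Cs a).gates[j]).fn = GateFn.maj ((Cs a).gates[j]).arity).card : ℝ) ≤ kmax) ∧
      (2 : ℝ) ^ (univ.filter fun j : Fin (Cs a).gates.length =>
          3 ≤ ((Cs a).gates[j]).arity ∧
            ((Cs a).gates[j]).fn = GateFn.maj ((Cs a).gates[j]).arity).card ≤ P) :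
    tailWeight (fun x : Fin n → Bool => sgn (F (fun a => (Cs a).eval x))) m
      ≤ 3 * ((K : ℝ) * (kmax + P * ((ACForm.cA : ℝ) ^ (d + 2) * (ACForm.cB : ℝ) ^ (d + 2) *
          (ACForm.logM (2 * s) : ℝ) ^ d / Real.log 2) / Real.sqrt m)) / Real.sqrt m := by
  have hmpos : (0 : ℝ) < m := Nat.cast_pos.2 (by omega)
  have hs0 : 0 < Real.sqrt m := Real.sqrt_pos.2 hmpos
  have hΦ0 := FewMaj.phi_nonneg d s
  refine stub_tailOfSens hm (fun x : Fin n → Bool => F (fun a => (Cs a).eval x)) (fun π => ?_)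
  have h := sens_comp_le F (fun a x => (Cs a).eval x) π
  refine h.trans ?_
  calc ∑ a : Fin K, ∑ x : Fin n → Bool, ((univ.filter fun j : Fin m =>
          (Cs a).eval x ≠ (Cs a).eval (fun i => xor (x i) (decide (π i = j)))).card : ℝ)
      ≤ ∑ _a : Fin K, (kmax * (2 ^ n * Real.sqrt m) + P * (2 ^ n *
          ((ACForm.cA : ℝ) ^ (d + 2) * (ACForm.cB : ℝ) ^ (d + 2) *
            (ACForm.logM (2 * s) : ℝ) ^ d / Real.log 2))) := by
        refine Finset.sum_le_sum fun a _ => ?_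
        obtain ⟨hB, hd, hs, hMd, hk, hP⟩ := hCs a
        refine (FewMaj3.sens_fewMaj_le (Cs a) hB hd hs h1 hMd π).trans ?_
        exact add_le_add (mul_le_mul_of_nonneg_right hk (by positivity))
          (mul_le_mul_of_nonneg_right hP (mul_nonneg (by positivity) hΦ0))
    _ = (K : ℝ) * (kmax + P * ((ACForm.cA : ℝ) ^ (d + 2) * (ACForm.cB : ℝ) ^ (d + 2) *
            (ACForm.logM (2 * s) : ℝ) ^ d / Real.log 2) / Real.sqrt m) * (2 ^ n * Real.sqrt m) := by
        rw [Finset.sum_const, Finset.card_univ, Fintype.card_fin, nsmul_eq_mul]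
        field_simp

end Waist

/-! ### The rung -/

/-- **The narrow-waist rung: `λ` is orthogonal to every Boolean function of `≤ n^β` few-majority
circuits** (unconditional). There are `β > 0` and `c₁ > 0` (depending only on the exponent of Bourgain's
Möbius–Walsh bound) such that for every depth `d`, size polynomial `p` and `ε > 0`, eventually in `n`:
for every `K ≤ n^β`, every `F : {0,1}^K → {0,1}` and every family `C_1, …, C_K` of circuits over
`tcBasis` on the `n` binary digits with `acDepth ≤ d`, `size ≤ p(n)`, every majority gate of fan-in
`≥ 3` at `acWeight`-depth `≤ 1` and at most `c₁ log n` of them,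
`|Σ_{N<2ⁿ} λ(N) sgn F(C_1(bits N), …, C_K(bits N))| ≤ ε 2ⁿ`. -/
theorem liouville_orthogonal_waist : ∃ β : ℝ, 0 < β ∧ ∃ c₁ : ℝ, 0 < c₁ ∧
    ∀ (d : ℕ) (p : Polynomial ℕ) (ε : ℝ), 0 < ε →
    ∀ᶠ n : ℕ in atTop, ∀ K : ℕ, (K : ℝ) ≤ (n : ℝ) ^ β → ∀ (F : (Fin K → Bool) → Bool)
      (Cs : Fin K → Circuit (Fin n)),
      (∀ a, (Cs a).IsOver tcBasis ∧ (Cs a).acDepth ≤ d ∧ (Cs a).size ≤ p.eval n ∧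
        (∀ (j : ℕ) (hj : j < (Cs a).gates.length),
          (∃ k, 3 ≤ k ∧ ((Cs a).gates[j]).fn = GateFn.maj k) →
            (GateList.wdepths acWeight (Cs a).gates).getD j 0 ≤ 1) ∧
        (((Finset.univ.filter fun j : Fin (Cs a).gates.length =>
            3 ≤ ((Cs a).gates[j]).arity ∧
              ((Cs a).gates[j]).fn = GateFn.maj ((Cs a).gates[j]).arity).card : ℝ)
          ≤ c₁ * Real.log n)) →
      |∑ N ∈ Finset.range (2 ^ n), ((ArithmeticFunction.liouville N : ℤ) : ℝ) *
          sgn (F (fun a => (Cs a).eval (fun i : Fin n => Nat.testBit N i)))| ≤ ε * (2 : ℝ) ^ n := by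
  obtain ⟨c, hc, hB⟩ := bourgain_liouville_walsh_holds
  set R : ℕ := ⌈(3 : ℝ) / c⌉₊ with hRdef
  have hR1 : 1 ≤ R := by
    have : (0 : ℝ) < 3 / c := by positivity
    exact Nat.one_le_iff_ne_zero.mpr (Nat.pos_iff_ne_zero.mp (Nat.ceil_pos.mpr this))
  have hRc : 3 ≤ (R : ℝ) * c := by
    have h1 : (3 : ℝ) / c ≤ R := Nat.le_ceil _
    have := mul_le_mul_of_nonneg_right h1 hc.le
    rwa [div_mul_cancel₀ _ hc.ne'] at this
  have hRpos : (0 : ℝ) < R := by exact_mod_cast (show 0 < R by omega)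
  set δ : ℝ := 1 / (2 * R) with hδdef
  have hδ : 0 < δ := by positivity
  have h2δ : 2 * δ = 1 / R := by rw [hδdef]; field_simp
  refine ⟨δ / 4, by positivity, δ / 4, by positivity, fun d p ε hε => ?_⟩
  have hε3 : 0 < (ε / 3) ^ 2 := by positivity
  have hδ4 : 0 < δ / 4 := by positivity
  have hδ52 : 0 < 5 * δ / 2 := by positivity
  -- the constants of the majorant `(3/2 + 3 KK Q) · n^{-δ/4}`
  set D : ℝ := 5 * ((p.natDegree : ℝ) + 2) with hDdef
  set KK : ℝ := (ACForm.cA : ℝ) ^ (d + 2) * (ACForm.cB : ℝ) ^ (d + 2) * D ^ d / Real.log 2 with hKKdef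
  have hl2 : 0 < Real.log 2 := Real.log_pos (by norm_num)
  have hKK0 : 0 ≤ KK := by rw [hKKdef, hDdef]; positivity
  set Q : ℝ := (2 * ((d : ℝ) + 1) / (5 * δ / 2)) ^ d with hQdef
  have hQ0 : 0 ≤ Q := by rw [hQdef]; positivity
  set M : ℝ := 3 / 2 + 3 * KK * Q with hMdef
  have hdec : Tendsto (fun n : ℕ => M * (n : ℝ) ^ (-(δ / 4))) atTop (𝓝 0) := by
    have h1 : Tendsto (fun n : ℕ => (n : ℝ) ^ (-(δ / 4))) atTop (𝓝 0) :=
      (tendsto_rpow_neg_atTop hδ4).comp tendsto_natCast_atTop_atTop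
    simpa using h1.const_mul M
  have hlev9 : ∀ᶠ n : ℕ in atTop, 9 ≤ ⌊((n : ℝ)) ^ ((1 : ℝ) / R)⌋₊ :=
    (LtfCore.tendsto_floor_rpow hR1).eventually (eventually_ge_atTop 9)
  filter_upwards [liouville_orthogonal_of_tailWeight_level hc hB hR1 hRc ε hε,
    hdec.eventually_le_const hε3, hlev9, eventually_ge_atTop 2, FewMaj3.eventually_logM_le p d]
    with n hn hsmall h9 hn2 hlogM K hK F Cs hCs
  refine hn (fun y => F (fun a => (Cs a).eval y)) ?_
  set kk : ℕ := ⌊((n : ℝ)) ^ ((1 : ℝ) / R)⌋₊ with hkkdef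
  set s : ℕ := max 2 (p.eval n) with hsdef
  have hs1 : 1 ≤ s := le_trans (by norm_num) (le_max_left _ _)
  have hnpos : (0 : ℝ) < n := by exact_mod_cast (show 0 < n by omega)
  have hn1 : (1 : ℝ) ≤ n := by exact_mod_cast (show 1 ≤ n by omega)
  have hlogn : 0 ≤ Real.log n := Real.log_nonneg hn1
  -- `2^k ≤ n^{δ/4}` from `k ≤ (δ/4) log n`
  have h2k : ∀ k : ℕ, (k : ℝ) ≤ δ / 4 * Real.log n → (2 : ℝ) ^ k ≤ (n : ℝ) ^ (δ / 4) := by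
    intro k hk
    have hlog2 : Real.log 2 ≤ 1 := by
      have := Real.log_two_lt_d9; linarith
    calc (2 : ℝ) ^ k = Real.exp (k * Real.log 2) := by
          rw [← Real.rpow_natCast, Real.rpow_def_of_pos (by norm_num)]; ring_nf
      _ ≤ Real.exp (δ / 4 * Real.log n) := by
          refine Real.exp_le_exp.2 ?_
          calc (k : ℝ) * Real.log 2 ≤ k * 1 := mul_le_mul_of_nonneg_left hlog2 (Nat.cast_nonneg k)
            _ = k := mul_one _
            _ ≤ δ / 4 * Real.log n := hk
      _ = (n : ℝ) ^ (δ / 4) := by rw [Real.rpow_def_of_pos hnpos]; ring_nf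
  -- the hypotheses of the accounting lemma, at `s = max 2 (p n)`, `kmax = (δ/4) log n`, `P = n^{δ/4}`
  have hCs' : ∀ a, (Cs a).IsOver tcBasis ∧ (Cs a).acDepth ≤ d ∧ (Cs a).size ≤ s ∧
      (∀ (j : ℕ) (hj : j < (Cs a).gates.length),
        (∃ k, 3 ≤ k ∧ ((Cs a).gates[j]).fn = GateFn.maj k) →
          (wdepths acWeight (Cs a).gates).getD j 0 ≤ 1) ∧
      (((univ.filter fun j : Fin (Cs a).gates.length =>
          3 ≤ ((Cs a).gates[j]).arity ∧
            ((Cs a).gates[j]).fn = GateFn.maj ((Cs a).gates[j]).arity).card : ℝ)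
        ≤ δ / 4 * Real.log n) ∧
      (2 : ℝ) ^ (univ.filter fun j : Fin (Cs a).gates.length =>
          3 ≤ ((Cs a).gates[j]).arity ∧
            ((Cs a).gates[j]).fn = GateFn.maj ((Cs a).gates[j]).arity).card ≤ (n : ℝ) ^ (δ / 4) := by
    intro a
    obtain ⟨hB', hd, hs, hMd, hk⟩ := hCs a
    exact ⟨hB', hd, hs.trans (le_max_right _ _), hMd, hk, h2k _ hk⟩
  have htail := Waist.tailWeight_comp_le (m := kk + 1) (by omega) F Cs hs1 hCs'
  refine htail.trans (le_trans ?_ hsmall)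
  -- abbreviations
  set Φ : ℝ := (ACForm.cA : ℝ) ^ (d + 2) * (ACForm.cB : ℝ) ^ (d + 2) *
    (ACForm.logM (2 * s) : ℝ) ^ d / Real.log 2 with hΦdef
  have hΦ0 : 0 ≤ Φ := by rw [hΦdef]; positivity
  -- the level: `n^δ ≤ √(kk+1)`, `n^{2δ} ≤ kk + 1`
  have hlev : (n : ℝ) ^ (2 * δ) < (kk : ℝ) + 1 := by rw [h2δ]; exact Nat.lt_floor_add_one _
  have hsq : (n : ℝ) ^ δ ≤ Real.sqrt ((((kk + 1 : ℕ) : ℝ))) := by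
    have h1 : Real.sqrt ((n : ℝ) ^ (2 * δ)) ≤ Real.sqrt ((kk : ℝ) + 1) := Real.sqrt_le_sqrt hlev.le
    have h2 : Real.sqrt ((n : ℝ) ^ (2 * δ)) = (n : ℝ) ^ δ := by
      rw [Real.sqrt_eq_rpow, ← Real.rpow_mul hnpos.le]; congr 1; ring
    rw [h2] at h1; push_cast; exact h1
  have hm : (n : ℝ) ^ (2 * δ) ≤ ((((kk + 1 : ℕ) : ℝ))) := by push_cast; exact hlev.le
  have hnδ : (0 : ℝ) < (n : ℝ) ^ δ := Real.rpow_pos_of_pos hnpos _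
  have hn2δ : (0 : ℝ) < (n : ℝ) ^ (2 * δ) := Real.rpow_pos_of_pos hnpos _
  have hnδ4 : (0 : ℝ) < (n : ℝ) ^ (δ / 4) := Real.rpow_pos_of_pos hnpos _
  have hs0 : (0 : ℝ) < Real.sqrt ((((kk + 1 : ℕ) : ℝ))) := lt_of_lt_of_le hnδ hsq
  have hm0 : (0 : ℝ) < ((((kk + 1 : ℕ) : ℝ))) := lt_of_lt_of_le hn2δ hm
  -- `Φ ≤ KK (log n)^d ≤ KK Q n^{5δ/4}`
  have hΦle : Φ ≤ KK * Q * (n : ℝ) ^ (5 * δ / 4) := by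
    have h1 : ((ACForm.logM (2 * s) : ℝ)) ^ d ≤ (D * Real.log n) ^ d := by
      rw [hDdef, hsdef]; exact hlogM
    have h2 : (D * Real.log n) ^ d = D ^ d * Real.log n ^ d := mul_pow _ _ _
    have h3 := FewMaj3.log_pow_le hδ52 d (show 1 ≤ n by omega)
    rw [show (5 : ℝ) * δ / 2 / 2 = 5 * δ / 4 by ring] at h3
    have hD0 : 0 ≤ D := by rw [hDdef]; positivity
    calc Φ = (ACForm.cA : ℝ) ^ (d + 2) * (ACForm.cB : ℝ) ^ (d + 2) / Real.log 2 *
          ((ACForm.logM (2 * s) : ℝ)) ^ d := by rw [hΦdef]; ring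
      _ ≤ (ACForm.cA : ℝ) ^ (d + 2) * (ACForm.cB : ℝ) ^ (d + 2) / Real.log 2 *
          (D ^ d * (Q * (n : ℝ) ^ (5 * δ / 4))) := by
          refine mul_le_mul_of_nonneg_left ?_ (by positivity)
          calc ((ACForm.logM (2 * s) : ℝ)) ^ d ≤ (D * Real.log n) ^ d := h1
            _ = D ^ d * Real.log n ^ d := h2
            _ ≤ D ^ d * (Q * (n : ℝ) ^ (5 * δ / 4)) :=
                mul_le_mul_of_nonneg_left (by rw [hQdef]; exact h3) (by positivity)
      _ = KK * Q * (n : ℝ) ^ (5 * δ / 4) := by rw [hKKdef]; ring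
  -- `log n ≤ (2/δ) n^{δ/2}`
  have hlogle : Real.log n ≤ (2 / δ) * (n : ℝ) ^ (δ / 2) := by
    have h := Real.log_natCast_le_rpow_div n (show 0 < δ / 2 by positivity)
    calc Real.log n ≤ (n : ℝ) ^ (δ / 2) / (δ / 2) := h
      _ = (2 / δ) * (n : ℝ) ^ (δ / 2) := by field_simp
  -- assemble: `3K(kmax + PΦ/√m)/√m ≤ 3 n^{δ/4}(δ/4)log n/n^δ + 3 n^{δ/2}Φ/n^{2δ} ≤ M n^{-δ/4}`
  have e1 : (n : ℝ) ^ (δ / 4) * (n : ℝ) ^ (δ / 2) / (n : ℝ) ^ δ = (n : ℝ) ^ (-(δ / 4)) := by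
    rw [← Real.rpow_add hnpos, ← Real.rpow_sub hnpos]; congr 1; ring
  have e2 : (n : ℝ) ^ (δ / 4) * (n : ℝ) ^ (δ / 4) * (n : ℝ) ^ (5 * δ / 4) / (n : ℝ) ^ (2 * δ) =
      (n : ℝ) ^ (-(δ / 4)) := by
    rw [← Real.rpow_add hnpos, ← Real.rpow_add hnpos, ← Real.rpow_sub hnpos]; congr 1; ring
  calc 3 * ((K : ℝ) * (δ / 4 * Real.log n +
          (n : ℝ) ^ (δ / 4) * Φ / Real.sqrt ((((kk + 1 : ℕ) : ℝ))))) / Real.sqrt ((((kk + 1 : ℕ) : ℝ)))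
      = 3 * ((K : ℝ) * (δ / 4 * Real.log n)) / Real.sqrt ((((kk + 1 : ℕ) : ℝ))) +
          3 * ((K : ℝ) * ((n : ℝ) ^ (δ / 4) * Φ)) /
            (Real.sqrt ((((kk + 1 : ℕ) : ℝ))) * Real.sqrt ((((kk + 1 : ℕ) : ℝ)))) := by
        field_simp
    _ = 3 * ((K : ℝ) * (δ / 4 * Real.log n)) / Real.sqrt ((((kk + 1 : ℕ) : ℝ))) +
          3 * ((K : ℝ) * ((n : ℝ) ^ (δ / 4) * Φ)) / ((((kk + 1 : ℕ) : ℝ))) := by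
        rw [Real.mul_self_sqrt hm0.le]
    _ ≤ 3 * ((K : ℝ) * (δ / 4 * Real.log n)) / (n : ℝ) ^ δ +
          3 * ((K : ℝ) * ((n : ℝ) ^ (δ / 4) * Φ)) / (n : ℝ) ^ (2 * δ) := by
        gcongr
    _ ≤ 3 * ((n : ℝ) ^ (δ / 4) * (δ / 4 * ((2 / δ) * (n : ℝ) ^ (δ / 2)))) / (n : ℝ) ^ δ +
          3 * ((n : ℝ) ^ (δ / 4) * ((n : ℝ) ^ (δ / 4) * (KK * Q * (n : ℝ) ^ (5 * δ / 4)))) /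
            (n : ℝ) ^ (2 * δ) := by
        gcongr
    _ = 3 / 2 * ((n : ℝ) ^ (δ / 4) * (n : ℝ) ^ (δ / 2) / (n : ℝ) ^ δ) +
          3 * KK * Q * ((n : ℝ) ^ (δ / 4) * (n : ℝ) ^ (δ / 4) * (n : ℝ) ^ (5 * δ / 4) /
            (n : ℝ) ^ (2 * δ)) := by
        field_simp
        ring
    _ = M * (n : ℝ) ^ (-(δ / 4)) := by rw [e1, e2, hMdef]; ring

/-- **Registered stub `stub_waist`** (W1; line `Sketch`, skeleton v9, lead c6): verbatim
`liouville_orthogonal_waist`. -/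
theorem stub_waist : ∃ β : ℝ, 0 < β ∧ ∃ c₁ : ℝ, 0 < c₁ ∧ ∀ (d : ℕ) (p : Polynomial ℕ) (ε : ℝ), 0 < ε → ∀ᶠ n : ℕ in atTop, ∀ K : ℕ, (K : ℝ) ≤ (n : ℝ) ^ β → ∀ (F : (Fin K → Bool) → Bool) (Cs : Fin K → Circuit (Fin n)), (∀ a, (Cs a).IsOver tcBasis ∧ (Cs a).acDepth ≤ d ∧ (Cs a).size ≤ p.eval n ∧ (∀ (j : ℕ) (hj : j < (Cs a).gates.length), (∃ k, 3 ≤ k ∧ ((Cs a).gates[j]).fn = GateFn.maj k) → (GateList.wdepths acWeight (Cs a).gates).getD j 0 ≤ 1) ∧ (((Finset.univ.filter fun j : Fin (Cs a).gates.length => 3 ≤ ((Cs a).gates[j]).arity ∧ ((Cs a).gates[j]).fn = GateFn.maj ((Cs a).gates[j]).arity).card : ℝ) ≤ c₁ * Real.log n)) → |∑ N ∈ Finset.range (2 ^ n), ((ArithmeticFunction.liouville N : ℤ) : ℝ) * sgn (F (fun a => (Cs a).eval (fun i : Fin n => Nat.testBit N i)))| ≤ ε * (2 : ℝ) ^ n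 :=
  liouville_orthogonal_waist

end Summit.QuantumAdvantage.QuantumAdvantage.Theorems.LiouvilleOrthogonalTC0

end
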